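import Summits.RiemannHypothesis.RiemannHypothesis.Theorems.NymanBeurlingTailKernel
import Mathlib.Analysis.SpecialFunctions.Log.Deriv
import HarnessLib

/-!
# RiemannHypothesis / Nyman–Beurling — the Farey means `m_n = n(n+1) log(1+1/n) − n`: generating series,
# `m_n < ½`, monotonicity, `m_n → ½`, two-sided bounds (RH-FREE, elementary)

Column LI/NB, rung L-P(P2), PROOF-OF-DATA infrastructure for cell `pub/rh-li` [rh-li-eng-3 g5].  The conditional expectation
`h = E[{1/x} | I_n] = Σ m_n 1_{I_n}` (`nbStepH`, `nbFareyMean`) drives the tail-constant identity (T3), the κ-law (T4/L5: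
`h₂ = Σ_{n≥2}(m_n − m_{n−1}) 1_{(0,1/n]}`) and `Q = (log 2π − γ − 1) − Σ m_n²/(n(n+1))` (`NbQValue`).  This file gives the exact
series in `r = 1/(2n+1)` (from Mathlib's `Real.hasSum_log_one_add_inv`):

  `½ − m_n = Σ_{j≥0} r^{2j+1}/((2j+1)(2j+3)) = r/3 + r³/15 + r⁵/35 + …`   (`hasSum_half_sub_nbFareyMean`),

whence `m_n < ½` (`nbFareyMean_lt_half`), `m_n ≤ m_{n+1}` (`nbFareyMean_mono`, so the weights `m_n − m_{n−1}` of `h₂` are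
non-negative), the two-sided bounds `r/3 ≤ ½ − m_n ≤ (r/3)/(1 − r²)` (`nbFareyMean_bounds`), and `m_n → ½` (`tendsto_nbFareyMean`).
RH-FREE [rh-li-eng-3 g5]: elementary real analysis; nothing here bears on the truth of RH.
-/

noncomputable section

set_option linter.dupNamespace false

open Filter Set Topology
open scoped Real

namespace Summit.RiemannHypothesis.RiemannHypothesis.Theorems.NbTheory

open Literature.NumberTheory.LFunctions

namespace FareyMean

/-- `m_n = n(n+1) log(1 + 1/n) − n` for `n ≥ 1` (the `if` removed). -/
lemma nbFareyMean_of_pos {n : ℕ} (hn : 0 < n) :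
    nbFareyMean n = (n : ℝ) * (n + 1) * Real.log (1 + 1 / n) - n := by
  rw [nbFareyMean, if_neg (by omega)]

/-- **The generating series:** for `n ≥ 1` and `r = 1/(2n+1)`,
`½ − m_n = Σ_{j≥0} r^{2j+1}/((2j+1)(2j+3))`. -/
theorem hasSum_half_sub_nbFareyMean {n : ℕ} (hn : 0 < n) :
    HasSum (fun j : ℕ ↦ (1 / (2 * (n : ℝ) + 1)) ^ (2 * j + 1) / ((2 * j + 1) * (2 * j + 3)))
      (1 / 2 - nbFareyMean n) := by
  have hn' : (0 : ℝ) < n := by exact_mod_cast hn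
  set r : ℝ := 1 / (2 * (n : ℝ) + 1) with hr
  have hr0 : 0 < r := by rw [hr]; positivity
  have hrn : r * (2 * n + 1) = 1 := by rw [hr]; field_simp
  -- Mathlib: `log(1 + 1/n) = Σ 2 r^{2k+1}/(2k+1)`
  have hL : HasSum (fun k : ℕ ↦ (2 : ℝ) * (1 / (2 * k + 1)) * r ^ (2 * k + 1)) (Real.log (1 + (n : ℝ)⁻¹)) :=
    Real.hasSum_log_one_add_inv hn'
  set L := Real.log (1 + (n : ℝ)⁻¹) with hLdef
  -- the shifted series `Σ a_{k+1} = L − a_0 = L − 2r`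
  have hL1 : HasSum (fun k : ℕ ↦ (2 : ℝ) * (1 / (2 * ((k + 1 : ℕ) : ℝ) + 1)) * r ^ (2 * (k + 1) + 1)) (L - 2 * r) := by
    have h := (hasSum_nat_add_iff' (f := fun k : ℕ ↦ (2 : ℝ) * (1 / (2 * k + 1)) * r ^ (2 * k + 1)) 1).2 hL
    simp only [Finset.range_one, Finset.sum_singleton, Nat.cast_zero, mul_zero, zero_add, pow_one, div_one,
      mul_one] at h
    exact h
  -- combine: `b_j = (a_j − a_{j+1}/r²)/4`
  have hcomb := (hL.sub (hL1.div_const (r ^ 2))).div_const 4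
  have hval : (L - (L - 2 * r) / r ^ 2) / 4 = 1 / 2 - nbFareyMean n := by
    rw [nbFareyMean_of_pos hn, hLdef, one_div]
    have hr2 : r ^ 2 ≠ 0 := pow_ne_zero 2 hr0.ne'
    -- `1/r = 2n+1`
    have hinv : (n : ℝ) = (1 / r - 1) / 2 := by rw [hr]; field_simp; ring
    rw [hinv]
    field_simp
    ring
  rw [← hval]
  refine hcomb.congr_fun fun j ↦ ?_
  push_cast
  have h1 : (2 * (j : ℝ) + 1) ≠ 0 := by positivity
  have h3 : (2 * (j : ℝ) + 3) ≠ 0 := by positivity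
  have hr2 : r ^ 2 ≠ 0 := pow_ne_zero 2 hr0.ne'
  rw [show 2 * ((j : ℝ) + 1) + 1 = 2 * j + 3 by ring, show 2 * (j + 1) + 1 = (2 * j + 1) + 2 by ring, pow_add]
  field_simp
  ring

/-- The terms of the generating series are positive. -/
lemma term_pos {n : ℕ} (j : ℕ) :
    0 < (1 / (2 * (n : ℝ) + 1)) ^ (2 * j + 1) / ((2 * j + 1) * (2 * j + 3)) := by positivity

end FareyMean

open FareyMean

/-- **Two-sided bounds:** for `n ≥ 1`, `r = 1/(2n+1)`: `r/3 ≤ ½ − m_n ≤ (r/3)/(1 − r²)`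
(first term, resp. the geometric majorant `Σ r^{2j+1}/3`). -/
theorem nbFareyMean_bounds {n : ℕ} (hn : 0 < n) :
    1 / (2 * (n : ℝ) + 1) / 3 ≤ 1 / 2 - nbFareyMean n ∧
      1 / 2 - nbFareyMean n ≤ (1 / (2 * (n : ℝ) + 1) / 3) / (1 - (1 / (2 * (n : ℝ) + 1)) ^ 2) := by
  have hs := hasSum_half_sub_nbFareyMean hn
  set r : ℝ := 1 / (2 * (n : ℝ) + 1) with hr
  have hn' : (1 : ℝ) ≤ n := by exact_mod_cast hn
  have hr0 : 0 < r := by rw [hr]; positivity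
  have hr1 : r < 1 := by rw [hr, div_lt_one (by positivity)]; linarith
  have hr2 : r ^ 2 < 1 := by nlinarith
  constructor
  · -- first term
    have h := sum_le_hasSum (f := fun j : ℕ ↦ r ^ (2 * j + 1) / ((2 * j + 1) * (2 * j + 3))) {0}
      (fun j _ ↦ (term_pos j).le) hs
    simp only [Finset.sum_singleton, Nat.cast_zero, mul_zero, zero_add, pow_one, mul_comm (1 : ℝ)] at h
    norm_num at h
    linarith
  · -- geometric majorant
    have hg : HasSum (fun j : ℕ ↦ r / 3 * (r ^ 2) ^ j) (r / 3 * (1 - r ^ 2)⁻¹) :=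
      (hasSum_geometric_of_lt_one (sq_nonneg r) hr2).mul_left (r / 3)
    have hle : ∀ j : ℕ, r ^ (2 * j + 1) / ((2 * j + 1) * (2 * j + 3)) ≤ r / 3 * (r ^ 2) ^ j := by
      intro j
      rw [pow_succ, pow_mul, div_eq_mul_inv]
      have hj : (3 : ℝ) ≤ (2 * j + 1) * (2 * j + 3) := by nlinarith [(j.cast_nonneg : (0 : ℝ) ≤ j)]
      have hinv : ((2 * (j : ℝ) + 1) * (2 * j + 3))⁻¹ ≤ 1 / 3 := by
        rw [one_div]; exact inv_anti₀ (by norm_num) hj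
      have hp : 0 ≤ (r ^ 2) ^ j * r := by positivity
      calc (r ^ 2) ^ j * r * ((2 * (j : ℝ) + 1) * (2 * j + 3))⁻¹ ≤ (r ^ 2) ^ j * r * (1 / 3) :=
            mul_le_mul_of_nonneg_left hinv hp
        _ = r / 3 * (r ^ 2) ^ j := by ring
    have h := hasSum_le hle hs hg
    calc 1 / 2 - nbFareyMean n ≤ r / 3 * (1 - r ^ 2)⁻¹ := h
      _ = r / 3 / (1 - r ^ 2) := by ring

/-- **`m_n < ½`** for every `n`. -/
theorem nbFareyMean_lt_half (n : ℕ) : nbFareyMean n < 1 / 2 := by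
  rcases Nat.eq_zero_or_pos n with h | h
  · subst h; simp [nbFareyMean]
  · obtain ⟨h1, -⟩ := nbFareyMean_bounds h
    have hpos : 0 < 1 / (2 * (n : ℝ) + 1) / 3 := by positivity
    linarith

/-- **Monotonicity: `m_n ≤ m_{n+1}`** (the series terms decrease with `n`); in particular the weights `m_n − m_{n−1}` of
`h₂ = Σ_{n≥2}(m_n − m_{n−1}) 1_{(0,1/n]}` are non-negative. -/
theorem nbFareyMean_mono : Monotone nbFareyMean := by
  refine monotone_nat_of_le_succ fun n ↦ ?_
  rcases Nat.eq_zero_or_pos n with h | h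
  · subst h
    simp only [zero_add]
    have : nbFareyMean 0 = 0 := by simp [nbFareyMean]
    rw [this]
    exact nbFareyMean_nonneg 1
  · have hs := hasSum_half_sub_nbFareyMean h
    have hs1 := hasSum_half_sub_nbFareyMean (Nat.succ_pos n)
    have hle : ∀ j : ℕ, (1 / (2 * ((n + 1 : ℕ) : ℝ) + 1)) ^ (2 * j + 1) / ((2 * j + 1) * (2 * j + 3)) ≤
        (1 / (2 * (n : ℝ) + 1)) ^ (2 * j + 1) / ((2 * j + 1) * (2 * j + 3)) := by
      intro j
      refine div_le_div_of_nonneg_right (pow_le_pow_left₀ (by positivity) ?_ _) (by positivity)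
      push_cast
      exact one_div_le_one_div_of_le (by positivity) (by linarith)
    have := hasSum_le hle hs1 hs
    linarith

/-- **`m_n → ½`.** -/
theorem tendsto_nbFareyMean : Tendsto nbFareyMean atTop (𝓝 (1 / 2)) := by
  -- `0 ≤ ½ − m_n ≤ (r/3)/(1 − r²) ≤ r` eventually, and `r = 1/(2n+1) → 0`
  have hr : Tendsto (fun n : ℕ ↦ 1 / (2 * (n : ℝ) + 1)) atTop (𝓝 0) := by
    have h1 : Tendsto (fun n : ℕ ↦ 2 * (n : ℝ) + 1) atTop atTop :=
      tendsto_atTop_add_const_right _ _ (tendsto_natCast_atTop_atTop.const_mul_atTop two_pos)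
    refine (h1.inv_tendsto_atTop).congr fun n ↦ ?_
    simp only [Pi.inv_apply, one_div]
  have hdiff : Tendsto (fun n : ℕ ↦ 1 / 2 - nbFareyMean n) atTop (𝓝 0) := by
    refine squeeze_zero' ?_ ?_ hr
    · filter_upwards with n
      linarith [nbFareyMean_lt_half n]
    · filter_upwards [eventually_ge_atTop 1] with n hn
      obtain ⟨-, h2⟩ := nbFareyMean_bounds (show 0 < n by omega)
      set r : ℝ := 1 / (2 * (n : ℝ) + 1)
      have hn' : (1 : ℝ) ≤ n := by exact_mod_cast hn
      have hr0 : 0 < r := by positivity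
      have hr3 : r ≤ 1 / 3 := by
        rw [show r = 1 / (2 * (n : ℝ) + 1) from rfl]
        exact one_div_le_one_div_of_le (by norm_num) (by linarith)
      have hden : 2 / 3 ≤ 1 - r ^ 2 := by nlinarith
      calc 1 / 2 - nbFareyMean n ≤ r / 3 / (1 - r ^ 2) := h2
        _ ≤ r / 3 / (2 / 3) := div_le_div_of_nonneg_left (by positivity) (by norm_num) hden
        _ = r / 2 := by ring
        _ ≤ r := by linarith
  have h := (tendsto_const_nhds (x := (1 / 2 : ℝ))).sub hdiff
  rw [sub_zero] at h
  exact h.congr fun n ↦ by ring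

end Summit.RiemannHypothesis.RiemannHypothesis.Theorems.NbTheory

end
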